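import Literature.MathematicalPhysics.QuantumLattice.Imbrie2016.UmbilicPlanes

/-!
# Imbrie (2016), the three-spin block: a product state is never far from the umbilic plane

[cite: ImbrieJSP2016, eq. (1.1), assumption LLA(ν, C)]  Repair cell b2b-imbrie, LLA.md block Q
(gen 9), Q5(c) "non-umbilic census of the five-level family".  In the five-level reduction of the
three-spin block `H = D + t₁X₁ + t₂X₂ + t₃X₃` of [ImbrieJSP2016, eq. (1.1)] (LLA.md Q4(c)) the
quartet of one `σ₂`-sector couples to a level of the other sector through a dressed real PRODUCT
state `ψ = x ⊗ y` of the outer spins.  The first-order non-umbilicity hypothesis (NU) of the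
meta-theorem (C5) of LLA.md Q5 holds at the decoupled point (all quartet fields zero, coupling
`t₂ > 0`) iff the umbilic plane `Ω = span{Ω₁ s, Ω₂ s}` of `UmbilicPlanes` is not contained in
`ψ^⊥`.  This file proves the quantitative form used there: by the Brahmagupta–Fibonacci identity the
squared norm of the orthogonal projection of `ψ` onto `Ω` equals `1/2` for EVERY real product unit
state — a product state makes an angle of exactly 45° with the umbilic plane.  Finite identities
over the 8 configurations; conventions (`sgn`, `Ket`, `inner`, `Ω₁`, `Ω₂`) are those of
`UmbilicPlanes`.
-/

namespace Literature.MathematicalPhysics.QuantumLattice.Imbrie2016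

open Finset BigOperators

namespace ProductStateOmegaOverlap

open UmbilicPlanes

/-- [cite: ImbrieJSP2016, eq. (1.1)] the real product ket `x ⊗ |s⟩ ⊗ y` of the two outer spins in
the middle sector `s`: `ψ(σ₁,σ₂,σ₃) = x σ₁ · [σ₂ = s] · y σ₃`. -/
noncomputable def prodKet (s : Fin 2) (x y : Fin 2 → ℝ) : Ket :=
  fun a b c => x a * ((1 + sgn b * sgn s) / 2) * y c

/-- [cite: ImbrieJSP2016, eq. (1.1)] overlap with `Ω₁ s = |+,s,−⟩ + |−,s,+⟩`. -/
theorem inner_Ω₁_prodKet (s : Fin 2) (x y : Fin 2 → ℝ) :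
    inner (Ω₁ s) (prodKet s x y) = x 0 * y 1 + x 1 * y 0 := by
  fin_cases s <;> norm_num [UmbilicPlanes.inner, prodKet, Ω₁, sgn, Fin.sum_univ_two]

/-- [cite: ImbrieJSP2016, eq. (1.1)] overlap with `Ω₂ s = |−,s,−⟩ − |+,s,+⟩`. -/
theorem inner_Ω₂_prodKet (s : Fin 2) (x y : Fin 2 → ℝ) :
    inner (Ω₂ s) (prodKet s x y) = x 1 * y 1 - x 0 * y 0 := by
  fin_cases s <;> norm_num [UmbilicPlanes.inner, prodKet, Ω₂, sgn, Fin.sum_univ_two] <;> ring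

/-- [cite: ImbrieJSP2016, eq. (1.1)] squared norm of the product ket. -/
theorem inner_prodKet_self (s : Fin 2) (x y : Fin 2 → ℝ) :
    inner (prodKet s x y) (prodKet s x y) = (x 0 ^ 2 + x 1 ^ 2) * (y 0 ^ 2 + y 1 ^ 2) := by
  fin_cases s <;> norm_num [UmbilicPlanes.inner, prodKet, sgn, Fin.sum_univ_two] <;> ring

/-- [cite: ImbrieJSP2016, eq. (1.1)] BRAHMAGUPTA–FIBONACCI FORM: the sum of the squared overlaps of a
product ket with `Ω₁ s`, `Ω₂ s` equals its squared norm (the two overlaps are the two bilinear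
forms of the identity `(x₀y₁ + x₁y₀)² + (x₁y₁ − x₀y₀)² = (x₀² + x₁²)(y₀² + y₁²)`). -/
theorem overlap_sq_sum (s : Fin 2) (x y : Fin 2 → ℝ) :
    inner (Ω₁ s) (prodKet s x y) ^ 2 + inner (Ω₂ s) (prodKet s x y) ^ 2 =
      inner (prodKet s x y) (prodKet s x y) := by
  rw [inner_Ω₁_prodKet, inner_Ω₂_prodKet, inner_prodKet_self]; ring

/-- [cite: ImbrieJSP2016, eq. (1.1)] THE 45° LAW: for real unit vectors `x`, `y` the squared norm of
the orthogonal projection of `x ⊗ |s⟩ ⊗ y` onto the umbilic plane `span{Ω₁ s, Ω₂ s}` — computed in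
the orthogonal basis `Ω₁ s, Ω₂ s` of squared norms `2, 2` (`UmbilicPlanes.inner_Ω`) — is exactly
`1/2`. -/
theorem projection_sq_norm_eq_half (s : Fin 2) (x y : Fin 2 → ℝ)
    (hx : x 0 ^ 2 + x 1 ^ 2 = 1) (hy : y 0 ^ 2 + y 1 ^ 2 = 1) :
    inner (Ω₁ s) (prodKet s x y) ^ 2 / inner (Ω₁ s) (Ω₁ s) +
      inner (Ω₂ s) (prodKet s x y) ^ 2 / inner (Ω₂ s) (Ω₂ s) = 1 / 2 := by
  obtain ⟨_, h₁, h₂⟩ := inner_Ω s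
  rw [h₁, h₂, ← add_div, overlap_sq_sum, inner_prodKet_self, hx, hy]; norm_num

/-- [cite: ImbrieJSP2016, eq. (1.1)] Consequently the umbilic plane is never inside `ψ^⊥` for a
non-zero product ket `ψ`: (NU) of LLA.md Q5 holds at the decoupled point for every dressing. -/
theorem umbilic_not_orthogonal (s : Fin 2) (x y : Fin 2 → ℝ)
    (hψ : inner (prodKet s x y) (prodKet s x y) ≠ 0) :
    ¬ (inner (Ω₁ s) (prodKet s x y) = 0 ∧ inner (Ω₂ s) (prodKet s x y) = 0) := by
  rintro ⟨h₁, h₂⟩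
  apply hψ
  rw [← overlap_sq_sum, h₁, h₂]; norm_num

end ProductStateOmegaOverlap

end Literature.MathematicalPhysics.QuantumLattice.Imbrie2016
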